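import Literature.MathematicalPhysics.QuantumLattice.SU2HaarChart
import Literature.Geometry.GaugeTheory.SpinorAlgebraFour
import Literature.MathematicalPhysics.QuantumFieldTheory.Balaban1983to89.BlockAveragingSU2
import Literature.MathematicalPhysics.QuantumFieldTheory.Balaban1983to89.T4RadialProjectionAC

/-!
# T4HaarSU2Translate — Haar measure on `SU(2)` under the translated radial projection `g ↦ p · (ĝ + a)/|ĝ + a| · q`

Module M2 of the plan `HOME/t4/T4-EST-HaarAC.md` (pub-balaban, row T4-D.G-AC2) toward the absolute-continuity input
`HaarAC (BlockAveraging.avgFun su2Mean)` of `T4FiniteEpsInhabited` (B12 = [Balaban1987RG1] (0.3)–(0.4) p.253, the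
block-averaging δ-kernel of B7 = [Balaban1985Averaging] (10) p.19; located gap GAPS G-pv26g2-1). PURPOSE ONLY — no journal
text is typed in this module; everything below is [folklore] over Mathlib and the tree's quaternion model of `SU(2)`
(`QuantumLattice.SU2Haar`: `quatMatrix`, `su2Quat`, `quatToSU2`, `haarProbability_su2_eq_su2BallMeasure`; additivity of `quatMatrix`
and the basis `quatBasis` are reused from `Geometry.GaugeTheory.SpinorAlgebraFour`).

CONTENT.
* §1 Quaternion bookkeeping: `quatMatrix` of finite sums (`quatMatrix_sum`), injective on the nose
  (`su2Quat_eq_of_coe_eq`), `su2Quat` is multiplicative and continuous, right equivariance `quatToSU2_mul`, the sum of an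
  `SU(2)` family is a quaternion matrix (`qsum_eq_quatMatrix`), and THE DICTIONARY `SU2Mean.projMat (quatMatrix q) = quatToSU2 q`
  (`projMat_quatMatrix`): Bałaban-type projected means are radial projections in `ℍ ≅ ℝ⁴`.
* §2 The one-variable map `translateProj a g := quatToSU2 (su2Quat g + a)` (`a : ℍ`), measurable.
* §3 NULL SETS: `haarProbability SU(2) N = 0 ↔ volume (quatToSU2 ⁻¹' N) = 0` (cone criterion from the tree's ball chart and
  scale invariance `quatToSU2_smul`).
* §4 MAIN THEOREM `haar_map_mul_translateProj_mul_absolutelyContinuous`: for every `a : ℍ` and `p q ∈ SU(2)`,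
  `(haarProbability SU(2)).map (g ↦ p * translateProj a g * q) ≪ haarProbability SU(2)`. Proof: in the cone picture the map is
  the 1-homogeneous extension `homExt a : x ↦ x + ‖x‖ • a` of module M1 (`T4RadialProjectionAC`), whose null-set preimages
  are null off the null degenerate cone (`measure_inter_preimage_homExt_null`, `measure_degenerateCone`, `dim_ℝ ℍ = 4 ≥ 2`);
  `p, q` are removed by two-sided invariance of Haar measure (`HaarData`).
Also restated for the cell's `HaarData.haar` (definitionally `haarProbability`, `UnitaryModel`).

VALUE = kernel measure theory on `SU(2)`; NOT an estimate of the papers, NOT summit progress.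
-/

noncomputable section

open MeasureTheory Set Metric Function
open scoped Quaternion ENNReal Pointwise Topology

namespace Literature.MathematicalPhysics.QuantumFieldTheory.Balaban1983to89.T4HaarSU2Translate

open Literature.MathematicalPhysics.QuantumLattice (quatMatrix quatMatrix_apply_00 quatMatrix_apply_01 quatMatrix_mul
  quatMatrix_one quatMatrix_smul det_quatMatrix quatMatrix_su2Quat su2Quat norm_su2Quat su2Quat_ne_zero quatToSU2
  coe_quatToSU2 coe_quatToSU2_of_norm_eq_one quatToSU2_su2Quat mul_quatToSU2 measurable_quatToSU2 quatToSU2_smul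
  su2BallMeasure haarProbability_su2_eq_su2BallMeasure volume_ball_quat_ne_zero volume_ball_quat_ne_top
  secondCountableTopology_su2)
open Literature.Geometry.GaugeTheory (quatMatrix_add quatMatrix_zero quatMatrixLinear quatBasis)
open T4RadialProjectionAC (homExt degenerateCone measure_inter_preimage_homExt_null measure_degenerateCone
  measure_Ioi_smul_null)

/-! ## 1. Quaternion bookkeeping -/

/-- `quatMatrix` of a finite sum. [folklore] -/
theorem quatMatrix_sum {ι : Type*} (s : Finset ι) (f : ι → ℍ) :
    quatMatrix (∑ i ∈ s, f i) = ∑ i ∈ s, quatMatrix (f i) :=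
  map_sum quatMatrixLinear f s

/-- Reading the quaternion back: if the matrix of `U ∈ SU(2)` is `quatMatrix q` then `su2Quat U = q`. [folklore] -/
theorem su2Quat_eq_of_coe_eq {U : Matrix.specialUnitaryGroup (Fin 2) ℂ} {q : ℍ}
    (h : (U : Matrix (Fin 2) (Fin 2) ℂ) = quatMatrix q) : su2Quat U = q := by
  ext <;> simp [su2Quat, h]

/-- `su2Quat (quatToSU2 x) = x/‖x‖` for `x ≠ 0`. [folklore] -/
theorem su2Quat_quatToSU2 {x : ℍ} (hx : x ≠ 0) : su2Quat (quatToSU2 x) = ‖x‖⁻¹ • x :=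
  su2Quat_eq_of_coe_eq (coe_quatToSU2 hx)

/-- `su2Quat` is multiplicative. [folklore] -/
theorem su2Quat_mul (U W : Matrix.specialUnitaryGroup (Fin 2) ℂ) : su2Quat (U * W) = su2Quat U * su2Quat W :=
  su2Quat_eq_of_coe_eq (by rw [quatMatrix_mul, quatMatrix_su2Quat, quatMatrix_su2Quat]; rfl)

/-- `su2Quat 1 = 1`. [folklore] -/
theorem su2Quat_one : su2Quat (1 : Matrix.specialUnitaryGroup (Fin 2) ℂ) = 1 :=
  su2Quat_eq_of_coe_eq (by rw [quatMatrix_one]; rfl)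

/-- `su2Quat` in the real basis `1, i, j, k` of `ℍ`. [folklore] -/
theorem su2Quat_eq_smul_add (U : Matrix.specialUnitaryGroup (Fin 2) ℂ) :
    su2Quat U = ((U : Matrix (Fin 2) (Fin 2) ℂ) 0 0).re • quatBasis 0 + ((U : Matrix (Fin 2) (Fin 2) ℂ) 0 0).im • quatBasis 1
      + ((U : Matrix (Fin 2) (Fin 2) ℂ) 0 1).re • quatBasis 2 + ((U : Matrix (Fin 2) (Fin 2) ℂ) 0 1).im • quatBasis 3 := by
  ext <;> simp [su2Quat]

/-- `su2Quat : SU(2) → ℍ` is continuous. [folklore] -/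
theorem continuous_su2Quat : Continuous (su2Quat : Matrix.specialUnitaryGroup (Fin 2) ℂ → ℍ) := by
  have h00 : Continuous fun U : Matrix.specialUnitaryGroup (Fin 2) ℂ => (U : Matrix (Fin 2) (Fin 2) ℂ) 0 0 :=
    continuous_subtype_val.matrix_elem 0 0
  have h01 : Continuous fun U : Matrix.specialUnitaryGroup (Fin 2) ℂ => (U : Matrix (Fin 2) (Fin 2) ℂ) 0 1 :=
    continuous_subtype_val.matrix_elem 0 1
  have h : Continuous fun U : Matrix.specialUnitaryGroup (Fin 2) ℂ =>
      ((U : Matrix (Fin 2) (Fin 2) ℂ) 0 0).re • quatBasis 0 + ((U : Matrix (Fin 2) (Fin 2) ℂ) 0 0).im • quatBasis 1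
        + ((U : Matrix (Fin 2) (Fin 2) ℂ) 0 1).re • quatBasis 2 + ((U : Matrix (Fin 2) (Fin 2) ℂ) 0 1).im • quatBasis 3 :=
    ((((Complex.continuous_re.comp h00).smul continuous_const).add
      ((Complex.continuous_im.comp h00).smul continuous_const)).add
      ((Complex.continuous_re.comp h01).smul continuous_const)).add
      ((Complex.continuous_im.comp h01).smul continuous_const)
  exact h.congr fun U => (su2Quat_eq_smul_add U).symm

/-- Right equivariance: `quatToSU2 x · U = quatToSU2 (x · su2Quat U)` (`x ≠ 0`). [folklore] -/
theorem quatToSU2_mul (U : Matrix.specialUnitaryGroup (Fin 2) ℂ) {x : ℍ} (hx : x ≠ 0) :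
    quatToSU2 x * U = quatToSU2 (x * su2Quat U) := by
  have hq := norm_su2Quat U
  have hxq : x * su2Quat U ≠ 0 := mul_ne_zero hx (su2Quat_ne_zero U)
  apply Subtype.ext
  rw [Submonoid.coe_mul, coe_quatToSU2 hx, coe_quatToSU2 hxq, ← quatMatrix_su2Quat U, ← quatMatrix_mul, smul_mul_assoc,
    norm_mul, hq, mul_one]

/-- Two-sided equivariance: `p · quatToSU2 x · q = quatToSU2 (su2Quat p · x · su2Quat q)` (`x ≠ 0`). [folklore] -/
theorem mul_quatToSU2_mul (p q : Matrix.specialUnitaryGroup (Fin 2) ℂ) {x : ℍ} (hx : x ≠ 0) :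
    p * quatToSU2 x * q = quatToSU2 (su2Quat p * x * su2Quat q) := by
  rw [mul_quatToSU2 p hx, quatToSU2_mul q (mul_ne_zero (su2Quat_ne_zero p) hx)]

/-- `U + quatMatrix a = quatMatrix (su2Quat U + a)`: translating an `SU(2)` matrix by a quaternion matrix. [folklore] -/
theorem coe_add_quatMatrix (U : Matrix.specialUnitaryGroup (Fin 2) ℂ) (a : ℍ) :
    (U : Matrix (Fin 2) (Fin 2) ℂ) + quatMatrix a = quatMatrix (su2Quat U + a) := by
  rw [quatMatrix_add, quatMatrix_su2Quat]

/-- A finite sum of `SU(2)` matrices is a quaternion matrix: `Σ_{i ∈ s} W_i = quatMatrix (Σ_{i ∈ s} su2Quat W_i)`. [folklore] -/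
theorem sum_coe_eq_quatMatrix {ι : Type*} (s : Finset ι) (W : ι → Matrix.specialUnitaryGroup (Fin 2) ℂ) :
    ∑ i ∈ s, (W i : Matrix (Fin 2) (Fin 2) ℂ) = quatMatrix (∑ i ∈ s, su2Quat (W i)) := by
  rw [quatMatrix_sum]
  exact Finset.sum_congr rfl fun i _ => (quatMatrix_su2Quat (W i)).symm

/-- The Euclidean barycentre of an `SU(2)` family is a quaternion matrix: `Σ_i W_i = quatMatrix (Σ_i su2Quat W_i)`. [folklore] -/
theorem qsum_eq_quatMatrix {ι : Type*} [Fintype ι] (W : ι → Matrix.specialUnitaryGroup (Fin 2) ℂ) :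
    SU2Mean.qsum W = quatMatrix (∑ i, su2Quat (W i)) :=
  sum_coe_eq_quatMatrix Finset.univ W

/-- **THE DICTIONARY.** The projected mean of `BlockAveragingSU2` on quaternion matrices is the radial projection of the
tree's quaternion model: `projMat (quatMatrix q) = quatToSU2 q` (both sides `1` at `q = 0`). [folklore] -/
theorem projMat_quatMatrix (q : ℍ) :
    SU2Mean.projMat (quatMatrix q) = (quatToSU2 q : Matrix (Fin 2) (Fin 2) ℂ) := by
  by_cases hq : q = 0
  · subst hq
    rw [quatMatrix_zero, SU2Mean.projMat_of_eq Matrix.det_zero]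
    simp [quatToSU2]
  · have hn : 0 < ‖q‖ := norm_pos_iff.2 hq
    have hdet : (quatMatrix q).det = (((‖q‖ * ‖q‖ : ℝ)) : ℂ) := by
      rw [det_quatMatrix, Quaternion.normSq_eq_norm_mul_self]
    have hdet0 : (quatMatrix q).det ≠ 0 := by
      rw [hdet]; exact_mod_cast (mul_pos hn hn).ne'
    rw [SU2Mean.projMat_of_ne hdet0, coe_quatToSU2 hq, quatMatrix_smul, hdet, Complex.ofReal_re,
      Real.sqrt_mul_self hn.le]

/-- `projMat q · V = projMat (q · V)` for `V ∈ SU(2)` and `det q ≠ 0`. [folklore] -/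
theorem projMat_mul_coe {q : Matrix (Fin 2) (Fin 2) ℂ} (hq : q.det ≠ 0) (V : Matrix.specialUnitaryGroup (Fin 2) ℂ) :
    SU2Mean.projMat q * (V : Matrix (Fin 2) (Fin 2) ℂ) = SU2Mean.projMat (q * (V : Matrix (Fin 2) (Fin 2) ℂ)) := by
  have h := SU2Mean.projMat_mul_mul (u := (1 : Matrix (Fin 2) (Fin 2) ℂ)) Matrix.det_one
    (Matrix.mem_specialUnitaryGroup_iff.1 V.2).2 hq
  simpa using h.symm

/-- `p · projMat q · r = projMat (p · q · r)` for `p, r ∈ SU(2)` and `det q ≠ 0`. [folklore] -/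
theorem coe_mul_projMat_mul_coe (p r : Matrix.specialUnitaryGroup (Fin 2) ℂ) {q : Matrix (Fin 2) (Fin 2) ℂ} (hq : q.det ≠ 0) :
    (p : Matrix (Fin 2) (Fin 2) ℂ) * SU2Mean.projMat q * (r : Matrix (Fin 2) (Fin 2) ℂ) =
      SU2Mean.projMat ((p : Matrix (Fin 2) (Fin 2) ℂ) * q * (r : Matrix (Fin 2) (Fin 2) ℂ)) :=
  (SU2Mean.projMat_mul_mul (Matrix.mem_specialUnitaryGroup_iff.1 p.2).2 (Matrix.mem_specialUnitaryGroup_iff.1 r.2).2 hq).symm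

/-! ## 2. The one-variable map -/

/-- `translateProj a g := quatToSU2 (su2Quat g + a)`: translate the unit quaternion of `g` by `a ∈ ℍ` and project back
radially to `SU(2)` (the one-variable shape of Bałaban's block average with the projected `SU(2)` mean, in the private
bond variable; value `1` at the single point `su2Quat g = -a`). [folklore] -/
def translateProj (a : ℍ) (g : Matrix.specialUnitaryGroup (Fin 2) ℂ) : Matrix.specialUnitaryGroup (Fin 2) ℂ :=
  quatToSU2 (su2Quat g + a)

/-- Unfolding lemma. [folklore] -/
theorem translateProj_apply (a : ℍ) (g : Matrix.specialUnitaryGroup (Fin 2) ℂ) :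
    translateProj a g = quatToSU2 (su2Quat g + a) := rfl

/-- At `a = 0` it is the identity. [folklore] -/
theorem translateProj_zero (g : Matrix.specialUnitaryGroup (Fin 2) ℂ) : translateProj 0 g = g := by
  rw [translateProj_apply, add_zero, quatToSU2_su2Quat]

/-- Matrix form: `translateProj a g = projMat (g + quatMatrix a)`. [folklore] -/
theorem coe_translateProj (a : ℍ) (g : Matrix.specialUnitaryGroup (Fin 2) ℂ) :
    (translateProj a g : Matrix (Fin 2) (Fin 2) ℂ) = SU2Mean.projMat ((g : Matrix (Fin 2) (Fin 2) ℂ) + quatMatrix a) := by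
  rw [coe_add_quatMatrix, projMat_quatMatrix, translateProj_apply]

/-- Two-sided translates off the exceptional point: `p · translateProj a g · q = quatToSU2 (p̂ (ĝ + a) q̂)`. [folklore] -/
theorem mul_translateProj_mul (p q : Matrix.specialUnitaryGroup (Fin 2) ℂ) (a : ℍ) {g : Matrix.specialUnitaryGroup (Fin 2) ℂ}
    (h : su2Quat g + a ≠ 0) : p * translateProj a g * q = quatToSU2 (su2Quat p * (su2Quat g + a) * su2Quat q) := by
  rw [translateProj_apply, mul_quatToSU2_mul p q h]

attribute [local instance] Literature.Analysis.FluidPDE.Tao2016.quatMeasurableSpace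
  Literature.Analysis.FluidPDE.Tao2016.quatBorelSpace

attribute [local instance] Literature.MathematicalPhysics.QuantumLattice.secondCountableTopology_su2

/-- `su2Quat` is measurable. [folklore] -/
theorem measurable_su2Quat : Measurable (su2Quat : Matrix.specialUnitaryGroup (Fin 2) ℂ → ℍ) :=
  continuous_su2Quat.measurable

/-- `translateProj a` is measurable. [folklore] -/
theorem measurable_translateProj (a : ℍ) : Measurable (translateProj a) :=
  measurable_quatToSU2.comp (measurable_su2Quat.add_const a)

/-- `g ↦ p · translateProj a g · q` is measurable. [folklore] -/
theorem measurable_mul_translateProj_mul (a : ℍ) (p q : Matrix.specialUnitaryGroup (Fin 2) ℂ) :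
    Measurable fun g : Matrix.specialUnitaryGroup (Fin 2) ℂ => p * translateProj a g * q :=
  ((measurable_translateProj a).const_mul p).mul_const q

/-! ## 3. Null sets of Haar measure in the cone picture -/

/-- CONE CRITERION (⇒): a Haar-null measurable set has a Lebesgue-null cone `quatToSU2 ⁻¹' N ⊆ ℍ`. [folklore] -/
theorem volume_preimage_quatToSU2_null {N : Set (Matrix.specialUnitaryGroup (Fin 2) ℂ)} (hN : MeasurableSet N)
    (h : haarProbability (Matrix.specialUnitaryGroup (Fin 2) ℂ) N = 0) :
    (volume : Measure ℍ) (quatToSU2 ⁻¹' N) = 0 := by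
  have hpre : MeasurableSet (quatToSU2 ⁻¹' N) := measurable_quatToSU2 hN
  rw [haarProbability_su2_eq_su2BallMeasure, su2BallMeasure, Measure.smul_apply, smul_eq_mul,
    Measure.map_apply measurable_quatToSU2 hN, Measure.restrict_apply hpre, mul_eq_zero] at h
  have hB : (volume : Measure ℍ) (quatToSU2 ⁻¹' N ∩ ball 0 1) = 0 := by
    rcases h with h | h
    · exact absurd h (ENNReal.inv_ne_zero.2 volume_ball_quat_ne_top)
    · exact h
  set S := quatToSU2 ⁻¹' N ∩ ball (0 : ℍ) 1 with hS
  -- the truncated cone over `S` is `S` itself (scale invariance), hence null; so is the full cone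
  have hIoo : (volume : Measure ℍ) (Ioo (0 : ℝ) 1 • S) = 0 := by
    refine measure_mono_null (fun x hx => ?_) hB
    obtain ⟨t, ht, y, hy, rfl⟩ := Set.mem_smul.1 hx
    refine ⟨?_, ?_⟩
    · show quatToSU2 (t • y) ∈ N
      rw [quatToSU2_smul ht.1]
      exact hy.1
    · rw [mem_ball_zero_iff, norm_smul, Real.norm_eq_abs, abs_of_pos ht.1]
      have := mem_ball_zero_iff.1 hy.2
      nlinarith [ht.1, ht.2, norm_nonneg y]
  have hIoi := measure_Ioi_smul_null (volume : Measure ℍ) hIoo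
  refine measure_mono_null (fun x hx => ?_) (measure_union_null (measure_singleton (0 : ℍ)) hIoi)
  by_cases hx0 : x = 0
  · exact Or.inl hx0
  refine Or.inr ?_
  have hn : 0 < ‖x‖ := norm_pos_iff.2 hx0
  have h2pos : (0 : ℝ) < 2 * ‖x‖ := mul_pos two_pos hn
  have h2 : (0 : ℝ) < (2 * ‖x‖)⁻¹ := inv_pos.2 h2pos
  rw [Set.mem_smul]
  refine ⟨2 * ‖x‖, mem_Ioi.2 h2pos, (2 * ‖x‖)⁻¹ • x, ⟨?_, ?_⟩, ?_⟩
  · show quatToSU2 ((2 * ‖x‖)⁻¹ • x) ∈ N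
    rw [quatToSU2_smul h2]
    exact hx
  · rw [mem_ball_zero_iff, norm_smul, Real.norm_eq_abs, abs_of_pos h2, inv_mul_eq_div, div_lt_one h2pos]
    linarith
  · rw [smul_smul, mul_inv_cancel₀ h2pos.ne', one_smul]

/-- CONE CRITERION (⇐): a measurable set with Lebesgue-null cone is Haar-null. [folklore] -/
theorem haar_null_of_volume_preimage_null {N : Set (Matrix.specialUnitaryGroup (Fin 2) ℂ)} (hN : MeasurableSet N)
    (h : (volume : Measure ℍ) (quatToSU2 ⁻¹' N) = 0) :
    haarProbability (Matrix.specialUnitaryGroup (Fin 2) ℂ) N = 0 := by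
  rw [haarProbability_su2_eq_su2BallMeasure, su2BallMeasure, Measure.smul_apply, smul_eq_mul,
    Measure.map_apply measurable_quatToSU2 hN, Measure.restrict_apply (measurable_quatToSU2 hN),
    measure_mono_null inter_subset_left h, mul_zero]

/-- CONE CRITERION: `Haar(N) = 0 ↔ vol (quatToSU2 ⁻¹' N) = 0` for measurable `N ⊆ SU(2)`. [folklore] -/
theorem haar_null_iff {N : Set (Matrix.specialUnitaryGroup (Fin 2) ℂ)} (hN : MeasurableSet N) :
    haarProbability (Matrix.specialUnitaryGroup (Fin 2) ℂ) N = 0 ↔ (volume : Measure ℍ) (quatToSU2 ⁻¹' N) = 0 :=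
  ⟨volume_preimage_quatToSU2_null hN, haar_null_of_volume_preimage_null hN⟩

/-! ## 4. Absolute continuity -/

/-- `dim_ℝ ℍ = 4 ≥ 2`. [folklore] -/
theorem two_le_finrank_quaternion : 2 ≤ Module.finrank ℝ ℍ := by
  rw [Quaternion.finrank_eq_four]; norm_num

/-- In the cone picture `translateProj a` is the 1-homogeneous extension `homExt a` of module M1:
`translateProj a (quatToSU2 x) = quatToSU2 (homExt a x)` for `x ≠ 0`. [folklore] -/
theorem translateProj_quatToSU2 (a : ℍ) {x : ℍ} (hx : x ≠ 0) :
    translateProj a (quatToSU2 x) = quatToSU2 (homExt a x) := by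
  have hn : 0 < ‖x‖ := norm_pos_iff.2 hx
  rw [translateProj_apply, su2Quat_quatToSU2 hx, homExt]
  have : x + ‖x‖ • a = ‖x‖ • (‖x‖⁻¹ • x + a) := by
    rw [smul_add, smul_smul, mul_inv_cancel₀ hn.ne', one_smul]
  rw [this, quatToSU2_smul hn]

/-- The preimage of a Haar-null set under `translateProj a` is Haar-null. [folklore] -/
theorem haar_preimage_translateProj_null (a : ℍ) {N : Set (Matrix.specialUnitaryGroup (Fin 2) ℂ)} (hN : MeasurableSet N)
    (h : haarProbability (Matrix.specialUnitaryGroup (Fin 2) ℂ) N = 0) :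
    haarProbability (Matrix.specialUnitaryGroup (Fin 2) ℂ) (translateProj a ⁻¹' N) = 0 := by
  have hN' : MeasurableSet (quatToSU2 ⁻¹' N) := measurable_quatToSU2 hN
  have hvN' : (volume : Measure ℍ) (quatToSU2 ⁻¹' N) = 0 := volume_preimage_quatToSU2_null hN h
  refine haar_null_of_volume_preimage_null (measurable_translateProj a hN) ?_
  have hA := measure_inter_preimage_homExt_null (volume : Measure ℍ) a hN' hvN'
  have hD := measure_degenerateCone (volume : Measure ℍ) a two_le_finrank_quaternion
  refine measure_mono_null (fun x hx => ?_)
    (measure_union_null (measure_singleton (0 : ℍ)) (measure_union_null hD hA))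
  by_cases hx0 : x = 0
  · exact Or.inl hx0
  refine Or.inr ?_
  by_cases hxD : x ∈ degenerateCone a
  · exact Or.inl hxD
  refine Or.inr ⟨hxD, ?_⟩
  show quatToSU2 (homExt a x) ∈ N
  rw [← translateProj_quatToSU2 a hx0]
  exact hx

/-- `(Haar).map (translateProj a) ≪ Haar` for every `a : ℍ`. [folklore] -/
theorem haar_map_translateProj_absolutelyContinuous (a : ℍ) :
    (haarProbability (Matrix.specialUnitaryGroup (Fin 2) ℂ)).map (translateProj a) ≪
      haarProbability (Matrix.specialUnitaryGroup (Fin 2) ℂ) := by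
  refine Measure.AbsolutelyContinuous.mk fun N hN h0 => ?_
  rw [Measure.map_apply (measurable_translateProj a) hN]
  exact haar_preimage_translateProj_null a hN h0

/-- The cell's `HaarData.haar` on `SU(2)` is the tree's `haarProbability` (definitionally, `UnitaryModel`). [folklore] -/
theorem haarData_haar_eq :
    (HaarData.haar : Measure (Matrix.specialUnitaryGroup (Fin 2) ℂ)) = haarProbability (Matrix.specialUnitaryGroup (Fin 2) ℂ) :=
  rfl

/-- Two-sided invariance of Haar measure on `SU(2)`: `(Haar).map (g ↦ p g q) = Haar`. [folklore] -/
theorem haar_map_mul_mul (p q : Matrix.specialUnitaryGroup (Fin 2) ℂ) :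
    (haarProbability (Matrix.specialUnitaryGroup (Fin 2) ℂ)).map (fun g => p * g * q) =
      haarProbability (Matrix.specialUnitaryGroup (Fin 2) ℂ) := by
  have hl := HaarData.map_mul_left (G := Matrix.specialUnitaryGroup (Fin 2) ℂ) p
  have hr := HaarData.map_mul_right (G := Matrix.specialUnitaryGroup (Fin 2) ℂ) q
  rw [haarData_haar_eq] at hl hr
  have hcomp : (fun g : Matrix.specialUnitaryGroup (Fin 2) ℂ => p * g * q) =
      (fun g : Matrix.specialUnitaryGroup (Fin 2) ℂ => g * q) ∘ (fun g => p * g) := rfl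
  rw [hcomp, ← Measure.map_map (measurable_mul_const q) (measurable_const_mul p), hl, hr]

/-- **M2 MAIN THEOREM.** For every `a : ℍ` and `p q ∈ SU(2)`, the law of `p · translateProj a g · q` under Haar measure is
absolutely continuous: `(Haar).map (g ↦ p · quatToSU2 (su2Quat g + a) · q) ≪ Haar`. [folklore] -/
theorem haar_map_mul_translateProj_mul_absolutelyContinuous (a : ℍ) (p q : Matrix.specialUnitaryGroup (Fin 2) ℂ) :
    (haarProbability (Matrix.specialUnitaryGroup (Fin 2) ℂ)).map (fun g => p * translateProj a g * q) ≪
      haarProbability (Matrix.specialUnitaryGroup (Fin 2) ℂ) := by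
  have hcomp : (fun g : Matrix.specialUnitaryGroup (Fin 2) ℂ => p * translateProj a g * q) =
      (fun h : Matrix.specialUnitaryGroup (Fin 2) ℂ => p * h * q) ∘ translateProj a := rfl
  have hm : Measurable fun h : Matrix.specialUnitaryGroup (Fin 2) ℂ => p * h * q :=
    (measurable_id.const_mul p).mul_const q
  rw [hcomp, ← Measure.map_map hm (measurable_translateProj a)]
  calc ((haarProbability (Matrix.specialUnitaryGroup (Fin 2) ℂ)).map (translateProj a)).map
        (fun h : Matrix.specialUnitaryGroup (Fin 2) ℂ => p * h * q)
      ≪ (haarProbability (Matrix.specialUnitaryGroup (Fin 2) ℂ)).map (fun h => p * h * q) :=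
        (haar_map_translateProj_absolutelyContinuous a).map hm
    _ = haarProbability (Matrix.specialUnitaryGroup (Fin 2) ℂ) := haar_map_mul_mul p q

/-- The same for the cell's `HaarData.haar` (the one-variable factor of `Setup.fieldMeasure`). [folklore] -/
theorem haarData_map_mul_translateProj_mul_absolutelyContinuous (a : ℍ) (p q : Matrix.specialUnitaryGroup (Fin 2) ℂ) :
    (HaarData.haar : Measure (Matrix.specialUnitaryGroup (Fin 2) ℂ)).map (fun g => p * translateProj a g * q) ≪ HaarData.haar :=
  haar_map_mul_translateProj_mul_absolutelyContinuous a p q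

/-- Two-sided invariance for `HaarData.haar` in the product form `g ↦ p g q`. [folklore] -/
theorem haarData_map_mul_mul (p q : Matrix.specialUnitaryGroup (Fin 2) ℂ) :
    (HaarData.haar : Measure (Matrix.specialUnitaryGroup (Fin 2) ℂ)).map (fun g => p * g * q) = HaarData.haar :=
  haar_map_mul_mul p q

end Literature.MathematicalPhysics.QuantumFieldTheory.Balaban1983to89.T4HaarSU2Translate

end
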